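import Literature.MathematicalPhysics.QuantumLattice.FermionGibbsVariationalPrinciple
import Literature.MathematicalPhysics.QuantumLattice.LayeredThermalEnergyWindows
import Literature.MathematicalPhysics.QuantumLattice.VariationalEquilibriumCoexistence
import HarnessLib

/-!
# Box certificates for thermodynamic-limit equilibrium states of general lattice-fermion models:
# pressures, conjugate densities and energies from finitely many box partition functions

Topic `Literature/MathematicalPhysics/QuantumLattice` (family `hubbard`; crew hubbard-fast S2 «T > 0 certifier for FAMILIES of models»).
Consumer layer of `FermionGibbsVariationalPrinciple.lean` (two-sided window `|P_var(β,Ψ) − (log Re Z_n + βc)/n^d| ≤ |β|·col_R(n)·S_Ψ/n^d`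
from ONE box `[0,n)^d`, every Hermitian even translation-covariant finite-range `Ψ` on `ℤ^d`) and of the Griffiths/Bogoliubov windows for
(ε-approximate) variational equilibrium states (`LayeredVariationalPressure`, `LayeredThermalEnergyWindows`, `VariationalEquilibriumCoexistence`):
CERTIFIED numbers `ℓ ≤ log Re Z_n ≤ u` (exact diagonalisation, interval arithmetic, or any rigorous two-sided method) at finitely many
couplings / temperatures give certified windows on

* §1 the thermodynamic-limit pressure: `le_varPressure_of_le_log_partitionFn`, `varPressure_le_of_log_partitionFn_le` (and `freePressure` forms);
* §2 (abstract) the conjugate densities `e_a(ν)` of every ε-approximate equilibrium state `ν` of a linear family `Ψ₀ + Σθ_aΨ_a` from a FLOOR on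
  `P(θ)` and CAPS on `P(θ ± δ1_a)` (`meanEnergy_mem_Icc_of_approx_of_bounds`), and its energy from a floor on `P(β)` and caps on `P(β ± δ)`
  (`meanEnergy_mem_Icc_of_approx_beta_of_bounds`) — monotone weakenings of the exact Griffiths windows;
* §3 the same windows fed by THREE BOX PARTITION FUNCTIONS (`meanEnergy_mem_Icc_of_approx_of_boxLogPartitionFn`,
  `meanEnergy_mem_Icc_of_approx_beta_of_boxLogPartitionFn`): e.g. the thermal double occupancy / density / bond energies of every
  thermodynamic-limit equilibrium state of a layered, `t''`, bilayer or multi-band (decorated) Hubbard model from ED of three small boxes, with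
  explicit slack `(|β| Σ col·S)/n^d` — certified, model by model, with no solver beyond the box traces.

Everything is PROVED; no definition, no named fact, no number. HONEST LIMITS: the slack is the free-boundary surface term `col_R(n) S_Ψ/n^d`
(`∼ 2dR‖Ψ‖/n`), so useful windows need `n` beyond the correlation scale or certified `log Z_n` from a better-than-ED method; exact
equilibria (`IsVarEquilibrium`) are not constructed here (ε-approximate ones always exist).

## Tree / Mathlib search

REUSED: `le_varPressure_of_box`, `varPressure_eq_freePressure` (`FermionGibbsVariationalPrinciple`); `varPressure_le_log_partitionFn_box`
(`VariationalPressureBoxPartitionFunctionBound`); `meanEnergy_mem_Icc_of_approx`, `varPressure_sub_mul_le_update_of_approx` (`LayeredVariationalPressure`);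
`meanEnergy_mem_Icc_of_approx_beta`, `varPressure_add_le_of_approx` (`LayeredThermalEnergyWindows` / `LayeredVariationalPressure`);
`isHermitian/isEven/isTranslationInvariant/hasFiniteRange_linearFamily` (`TIGroundEnergyDensityCouplingFamilies`).

## References

* R. B. Griffiths, J. Math. Phys. 5 (1964) 1215, eq. (39) (tangent bounds from convexity). [cite: Griffiths1964, Eq. (39) and Fig. 3]
* R. B. Israel, *Convexity in the Theory of Lattice Gases* (1979), Thm. I.2.4, Lemma II.3.1. [cite: Israel1979, Thm. I.2.4]
* O. Bratteli, D. W. Robinson, *OAQSM 2* (1997), Thm. 6.2.40. [cite: BratteliRobinsonII1997, Thm. 6.2.40]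
-/

noncomputable section

open scoped ComplexOrder BigOperators Matrix.Norms.L2Operator
open Finset Literature.InformationTheory.Entropy

namespace Literature.MathematicalPhysics.QuantumLattice

open Matrix HubbardWave0 Literature.Probability.LatticeModels ThermodynamicLimit
open _root_.Filter
open scoped _root_.Topology

variable {d : ℕ}

/-! ### §1. Certified box partition functions ⇒ certified pressure -/

namespace FermionInteraction

variable {Ψ : FermionInteraction d} {R : ℝ}

/-- **A certified LOWER bound `ℓ ≤ log Re Z_{[0,n)^d}` is a certified FLOOR on the thermodynamic-limit pressure**:
`(ℓ + β Re(Ψ∅))/n^d − |β| col_R(n) S_Ψ/n^d ≤ P_var(β,Ψ,R)`. [cite: BratteliRobinsonII1997, Thm. 6.2.40] [cite: Israel1979, Lemma II.3.1] -/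
theorem le_varPressure_of_le_log_partitionFn (hd : 0 < d) (hH : Ψ.IsHermitian) (hE : Ψ.IsEven) (hT : Ψ.IsTranslationInvariant)
    (hR : Ψ.HasFiniteRange R) (β : ℝ) {n : ℕ} (hn : 1 ≤ n) {ℓ : ℝ}
    (hℓ : ℓ ≤ Real.log (Matrix.partitionFn β (Ψ.localHamiltonian (halfOpenBox d n))).re) :
    (ℓ + β * ((Ψ.Φ ∅) ∅ ∅).re) / (n : ℝ) ^ d -
        |β| * ((((thicken (halfOpenBox d n) R \ halfOpenBox d n).card : ℝ) *
          ∑ X ∈ (thicken ({0} : Finset (Site d)) R).powerset with (0 : Site d) ∈ X, ‖Ψ.Φ X‖) / (n : ℝ) ^ d) ≤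
      Ψ.varPressure β R := by
  refine le_trans ?_ (le_varPressure_of_box hd hH hE hT hR β hn)
  have hnd : (0 : ℝ) < (n : ℝ) ^ d := by positivity
  have h1 : (ℓ + β * ((Ψ.Φ ∅) ∅ ∅).re) / (n : ℝ) ^ d ≤
      (Real.log (Matrix.partitionFn β (Ψ.localHamiltonian (halfOpenBox d n))).re + β * ((Ψ.Φ ∅) ∅ ∅).re) / (n : ℝ) ^ d :=
    div_le_div_of_nonneg_right (by linarith) hnd.le
  linarith

/-- **A certified UPPER bound `log Re Z_{[0,n)^d} ≤ u` is a certified CAP on the thermodynamic-limit pressure**: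
`P_var(β,Ψ,R) ≤ (u + β Re(Ψ∅))/n^d + |β| col_R(n) S_Ψ/n^d`. [cite: BratteliRobinsonII1997, Thm. 6.2.40] [cite: Israel1979, Lemma II.3.1] -/
theorem varPressure_le_of_log_partitionFn_le (hd : 0 < d) (hH : Ψ.IsHermitian) (hT : Ψ.IsTranslationInvariant)
    (hR : Ψ.HasFiniteRange R) (β : ℝ) {n : ℕ} (hn : 1 ≤ n) {u : ℝ}
    (hu : Real.log (Matrix.partitionFn β (Ψ.localHamiltonian (halfOpenBox d n))).re ≤ u) :
    Ψ.varPressure β R ≤ (u + β * ((Ψ.Φ ∅) ∅ ∅).re) / (n : ℝ) ^ d +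
        |β| * ((((thicken (halfOpenBox d n) R \ halfOpenBox d n).card : ℝ) *
          ∑ X ∈ (thicken ({0} : Finset (Site d)) R).powerset with (0 : Site d) ∈ X, ‖Ψ.Φ X‖) / (n : ℝ) ^ d) := by
  have hup := InfVolFermionState.varPressure_le_log_partitionFn_box hd hH hT hR β hn
  have hnd : (0 : ℝ) < (n : ℝ) ^ d := by positivity
  have h1 : Ψ.varPressure β R ≤
      (Real.log (Matrix.partitionFn β (Ψ.localHamiltonian (halfOpenBox d n))).re + β * ((Ψ.Φ ∅) ∅ ∅).re) / (n : ℝ) ^ d +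
        |β| * ((((thicken (halfOpenBox d n) R \ halfOpenBox d n).card : ℝ) *
          ∑ X ∈ (thicken ({0} : Finset (Site d)) R).powerset with (0 : Site d) ∈ X, ‖Ψ.Φ X‖) / (n : ℝ) ^ d) := by
    rw [← mul_div_assoc, ← add_div, le_div_iff₀' hnd]
    exact hup
  have h2 : (Real.log (Matrix.partitionFn β (Ψ.localHamiltonian (halfOpenBox d n))).re + β * ((Ψ.Φ ∅) ∅ ∅).re) / (n : ℝ) ^ d ≤
      (u + β * ((Ψ.Φ ∅) ∅ ∅).re) / (n : ℝ) ^ d := div_le_div_of_nonneg_right (by linarith) hnd.le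
  linarith

/-- Floor on the FREE-BOUNDARY pressure from a certified lower bound on one box (`β ≥ 0`). [cite: BratteliRobinsonII1997, Thm. 6.2.40] -/
theorem le_freePressure_of_le_log_partitionFn (hd : 0 < d) (hH : Ψ.IsHermitian) (hE : Ψ.IsEven) (hT : Ψ.IsTranslationInvariant)
    (hR : Ψ.HasFiniteRange R) {β : ℝ} (hβ : 0 ≤ β) {n : ℕ} (hn : 1 ≤ n) {ℓ : ℝ}
    (hℓ : ℓ ≤ Real.log (Matrix.partitionFn β (Ψ.localHamiltonian (halfOpenBox d n))).re) :
    (ℓ + β * ((Ψ.Φ ∅) ∅ ∅).re) / (n : ℝ) ^ d -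
        β * ((((thicken (halfOpenBox d n) R \ halfOpenBox d n).card : ℝ) *
          ∑ X ∈ (thicken ({0} : Finset (Site d)) R).powerset with (0 : Site d) ∈ X, ‖Ψ.Φ X‖) / (n : ℝ) ^ d) ≤
      Ψ.freePressure β := by
  rw [← varPressure_eq_freePressure hd hH hE hT hR hβ]
  have h := le_varPressure_of_le_log_partitionFn hd hH hE hT hR β hn hℓ
  rwa [abs_of_nonneg hβ] at h

/-- Cap on the FREE-BOUNDARY pressure from a certified upper bound on one box (`β ≥ 0`). [cite: BratteliRobinsonII1997, Thm. 6.2.40] -/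
theorem freePressure_le_of_log_partitionFn_le (hd : 0 < d) (hH : Ψ.IsHermitian) (hE : Ψ.IsEven) (hT : Ψ.IsTranslationInvariant)
    (hR : Ψ.HasFiniteRange R) {β : ℝ} (hβ : 0 ≤ β) {n : ℕ} (hn : 1 ≤ n) {u : ℝ}
    (hu : Real.log (Matrix.partitionFn β (Ψ.localHamiltonian (halfOpenBox d n))).re ≤ u) :
    Ψ.freePressure β ≤ (u + β * ((Ψ.Φ ∅) ∅ ∅).re) / (n : ℝ) ^ d +
        β * ((((thicken (halfOpenBox d n) R \ halfOpenBox d n).card : ℝ) *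
          ∑ X ∈ (thicken ({0} : Finset (Site d)) R).powerset with (0 : Site d) ∈ X, ‖Ψ.Φ X‖) / (n : ℝ) ^ d) := by
  rw [← varPressure_eq_freePressure hd hH hE hT hR hβ]
  have h := varPressure_le_of_log_partitionFn_le hd hH hT hR β hn hu
  rwa [abs_of_nonneg hβ] at h

end FermionInteraction

/-! ### §2. Conjugate densities and energies of approximate equilibria from pressure floors and caps -/

namespace InfVolFermionState

variable {β ε : ℝ} {R : ℝ} {ν : InfVolFermionState d}

section Couplings

variable {ι : Type*} [Fintype ι] [DecidableEq ι] {Ψ₀ : FermionInteraction d} {Ψv : ι → FermionInteraction d} {θ : ι → ℝ}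

/-- **Conjugate density of an ε-approximate equilibrium from a FLOOR at `θ` and CAPS at `θ ± δ1_a`** (`β, δ > 0`):
`L₀ ≤ P(θ)`, `P(θ+δ1_a) ≤ U₊`, `P(θ−δ1_a) ≤ U₋` give `(L₀ − U₊ − ε)/(βδ) ≤ e_a(ν) ≤ (U₋ − L₀ + ε)/(βδ)`.
[cite: Griffiths1964, Eq. (39) and Fig. 3] [cite: Israel1979, Thm. I.2.4] -/
theorem meanEnergy_mem_Icc_of_approx_of_bounds (hν : ν.IsTranslationInvariant) (hβ : 0 < β)
    (h : (FermionInteraction.linearFamily Ψ₀ Ψv θ).varPressure β R - ε ≤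
      ν.entropyDensitySup - β * ν.meanEnergy (FermionInteraction.linearFamily Ψ₀ Ψv θ) R)
    (a : ι) {δ : ℝ} (hδ : 0 < δ) {L₀ Uplus Uminus : ℝ}
    (hL : L₀ ≤ (FermionInteraction.linearFamily Ψ₀ Ψv θ).varPressure β R)
    (hUp : (FermionInteraction.linearFamily Ψ₀ Ψv (θ + Pi.single a δ)).varPressure β R ≤ Uplus)
    (hUm : (FermionInteraction.linearFamily Ψ₀ Ψv (θ + Pi.single a (-δ))).varPressure β R ≤ Uminus) :
    ν.meanEnergy (Ψv a) R ∈ Set.Icc ((L₀ - Uplus - ε) / (β * δ)) ((Uminus - L₀ + ε) / (β * δ)) := by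
  have hw := meanEnergy_mem_Icc_of_approx hν hβ h a hδ
  have hβδ : 0 < β * δ := mul_pos hβ hδ
  constructor
  · exact le_trans (div_le_div_of_nonneg_right (by linarith) hβδ.le) hw.1
  · exact le_trans hw.2 (div_le_div_of_nonneg_right (by linarith) hβδ.le)

/-- The same for an exact equilibrium state (`ε = 0`). [cite: Griffiths1964, Eq. (39) and Fig. 3] -/
theorem IsVarEquilibrium.meanEnergy_mem_Icc_of_bounds {ω : InfVolFermionState d} (hβ : 0 < β)
    (h : ω.IsVarEquilibrium β (FermionInteraction.linearFamily Ψ₀ Ψv θ) R) (a : ι) {δ : ℝ} (hδ : 0 < δ) {L₀ Uplus Uminus : ℝ}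
    (hL : L₀ ≤ (FermionInteraction.linearFamily Ψ₀ Ψv θ).varPressure β R)
    (hUp : (FermionInteraction.linearFamily Ψ₀ Ψv (θ + Pi.single a δ)).varPressure β R ≤ Uplus)
    (hUm : (FermionInteraction.linearFamily Ψ₀ Ψv (θ + Pi.single a (-δ))).varPressure β R ≤ Uminus) :
    ω.meanEnergy (Ψv a) R ∈ Set.Icc ((L₀ - Uplus) / (β * δ)) ((Uminus - L₀) / (β * δ)) := by
  have h0 := meanEnergy_mem_Icc_of_approx_of_bounds h.1 hβ h.approx_zero a hδ hL hUp hUm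
  simp only [sub_zero, add_zero] at h0
  exact h0

end Couplings

/-- **Energy of an ε-approximate equilibrium from a FLOOR at `β` and CAPS at `β ± δ`** (`δ > 0`):
`L ≤ P(β)`, `P(β+δ) ≤ U₊`, `P(β−δ) ≤ U₋` give `(L − U₊ − ε)/δ ≤ e_Φ(ν) ≤ (U₋ − L + ε)/δ`. [cite: Israel1979, Thm. I.2.4] -/
theorem meanEnergy_mem_Icc_of_approx_beta_of_bounds {Φ : FermionInteraction d} (hν : ν.IsTranslationInvariant)
    (h : Φ.varPressure β R - ε ≤ ν.entropyDensitySup - β * ν.meanEnergy Φ R) {δ : ℝ} (hδ : 0 < δ) {L Uplus Uminus : ℝ}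
    (hL : L ≤ Φ.varPressure β R) (hUp : Φ.varPressure (β + δ) R ≤ Uplus) (hUm : Φ.varPressure (β - δ) R ≤ Uminus) :
    ν.meanEnergy Φ R ∈ Set.Icc ((L - Uplus - ε) / δ) ((Uminus - L + ε) / δ) := by
  have hw := meanEnergy_mem_Icc_of_approx_beta hν h hδ
  constructor
  · exact le_trans (div_le_div_of_nonneg_right (by linarith) hδ.le) hw.1
  · exact le_trans hw.2 (div_le_div_of_nonneg_right (by linarith) hδ.le)

/-- The same for an exact equilibrium state. [cite: Israel1979, Thm. I.2.4] -/
theorem IsVarEquilibrium.meanEnergy_mem_Icc_beta_of_bounds {Φ : FermionInteraction d} {ω : InfVolFermionState d}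
    (h : ω.IsVarEquilibrium β Φ R) {δ : ℝ} (hδ : 0 < δ) {L Uplus Uminus : ℝ}
    (hL : L ≤ Φ.varPressure β R) (hUp : Φ.varPressure (β + δ) R ≤ Uplus) (hUm : Φ.varPressure (β - δ) R ≤ Uminus) :
    ω.meanEnergy Φ R ∈ Set.Icc ((L - Uplus) / δ) ((Uminus - L) / δ) := by
  have h0 := meanEnergy_mem_Icc_of_approx_beta_of_bounds h.1 h.approx_zero hδ hL hUp hUm
  simp only [sub_zero, add_zero] at h0
  exact h0

/-! ### §3. … fed by three box partition functions -/

/-- **THERMAL ENERGY OF EVERY (ε-APPROXIMATE) EQUILIBRIUM STATE FROM THREE BOX PARTITION FUNCTIONS** (one model `Φ`, temperatures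
`β−δ, β, β+δ`, `β > δ > 0` not needed — only `δ > 0`; box `[0,n)^d`, `n ≥ 1`, `d ≥ 1`): certified `ℓ ≤ log Re Z_n(β)`, `log Re Z_n(β±δ) ≤ u±` give
`e_Φ(ν) ∈ [(F_n(ℓ,β) − C_n(u₊,β+δ) − ε)/δ, (C_n(u₋,β−δ) − F_n(ℓ,β) + ε)/δ]` with the box floor/cap expressions
`F_n(ℓ,β) = (ℓ + βc)/n^d − |β| col S/n^d`, `C_n(u,β') = (u + β'c)/n^d + |β'| col S/n^d`. [cite: Israel1979, Thm. I.2.4]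
[cite: BratteliRobinsonII1997, Thm. 6.2.40] -/
theorem meanEnergy_mem_Icc_of_approx_beta_of_boxLogPartitionFn {Φ : FermionInteraction d} (hd : 0 < d) (hH : Φ.IsHermitian)
    (hE : Φ.IsEven) (hT : Φ.IsTranslationInvariant) (hR : Φ.HasFiniteRange R) (hν : ν.IsTranslationInvariant)
    (h : Φ.varPressure β R - ε ≤ ν.entropyDensitySup - β * ν.meanEnergy Φ R) {δ : ℝ} (hδ : 0 < δ) {n : ℕ} (hn : 1 ≤ n)
    {ℓ uplus uminus : ℝ}
    (hℓ : ℓ ≤ Real.log (Matrix.partitionFn β (Φ.localHamiltonian (halfOpenBox d n))).re)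
    (hup : Real.log (Matrix.partitionFn (β + δ) (Φ.localHamiltonian (halfOpenBox d n))).re ≤ uplus)
    (hum : Real.log (Matrix.partitionFn (β - δ) (Φ.localHamiltonian (halfOpenBox d n))).re ≤ uminus) :
    ν.meanEnergy Φ R ∈ Set.Icc
      ((((ℓ + β * ((Φ.Φ ∅) ∅ ∅).re) / (n : ℝ) ^ d -
          |β| * ((((thicken (halfOpenBox d n) R \ halfOpenBox d n).card : ℝ) *
            ∑ X ∈ (thicken ({0} : Finset (Site d)) R).powerset with (0 : Site d) ∈ X, ‖Φ.Φ X‖) / (n : ℝ) ^ d)) -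
        ((uplus + (β + δ) * ((Φ.Φ ∅) ∅ ∅).re) / (n : ℝ) ^ d +
          |β + δ| * ((((thicken (halfOpenBox d n) R \ halfOpenBox d n).card : ℝ) *
            ∑ X ∈ (thicken ({0} : Finset (Site d)) R).powerset with (0 : Site d) ∈ X, ‖Φ.Φ X‖) / (n : ℝ) ^ d)) - ε) / δ)
      ((((uminus + (β - δ) * ((Φ.Φ ∅) ∅ ∅).re) / (n : ℝ) ^ d +
          |β - δ| * ((((thicken (halfOpenBox d n) R \ halfOpenBox d n).card : ℝ) *
            ∑ X ∈ (thicken ({0} : Finset (Site d)) R).powerset with (0 : Site d) ∈ X, ‖Φ.Φ X‖) / (n : ℝ) ^ d)) -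
        ((ℓ + β * ((Φ.Φ ∅) ∅ ∅).re) / (n : ℝ) ^ d -
          |β| * ((((thicken (halfOpenBox d n) R \ halfOpenBox d n).card : ℝ) *
            ∑ X ∈ (thicken ({0} : Finset (Site d)) R).powerset with (0 : Site d) ∈ X, ‖Φ.Φ X‖) / (n : ℝ) ^ d)) + ε) / δ) :=
  meanEnergy_mem_Icc_of_approx_beta_of_bounds hν h hδ
    (FermionInteraction.le_varPressure_of_le_log_partitionFn hd hH hE hT hR β hn hℓ)
    (FermionInteraction.varPressure_le_of_log_partitionFn_le hd hH hT hR (β + δ) hn hup)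
    (FermionInteraction.varPressure_le_of_log_partitionFn_le hd hH hT hR (β - δ) hn hum)

section CouplingsBox

variable {ι : Type*} [Fintype ι] [DecidableEq ι] {Ψ₀ : FermionInteraction d} {Ψv : ι → FermionInteraction d} {θ : ι → ℝ}

/-- **CONJUGATE DENSITIES OF EVERY (ε-APPROXIMATE) EQUILIBRIUM STATE OF A LINEAR FAMILY FROM THREE BOX PARTITION FUNCTIONS**
(couplings `θ, θ ± δ1_a`; all members `Ψ(θ') = Ψ₀ + Σθ'_bΨ_b` Hermitian, even, translation covariant of range `R` through their components):
certified `ℓ ≤ log Re Z_n(θ)`, `log Re Z_n(θ ± δ1_a) ≤ u±` give the window of `meanEnergy_mem_Icc_of_approx_of_bounds` with the box floor at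
`θ` and the box caps at `θ ± δ1_a` — e.g. thermal density / double occupancy / bond energies of thermodynamic-limit equilibrium states of any
typed family from exact diagonalisation of three boxes. [cite: Griffiths1964, Eq. (39) and Fig. 3] [cite: BratteliRobinsonII1997, Thm. 6.2.40] -/
theorem meanEnergy_mem_Icc_of_approx_of_boxLogPartitionFn (hd : 0 < d)
    (h₀H : Ψ₀.IsHermitian) (hvH : ∀ b, (Ψv b).IsHermitian) (h₀E : Ψ₀.IsEven) (hvE : ∀ b, (Ψv b).IsEven)
    (h₀T : Ψ₀.IsTranslationInvariant) (hvT : ∀ b, (Ψv b).IsTranslationInvariant) (h₀R : Ψ₀.HasFiniteRange R)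
    (hvR : ∀ b, (Ψv b).HasFiniteRange R) (hν : ν.IsTranslationInvariant) (hβ : 0 < β)
    (h : (FermionInteraction.linearFamily Ψ₀ Ψv θ).varPressure β R - ε ≤
      ν.entropyDensitySup - β * ν.meanEnergy (FermionInteraction.linearFamily Ψ₀ Ψv θ) R)
    (a : ι) {δ : ℝ} (hδ : 0 < δ) {n : ℕ} (hn : 1 ≤ n) {ℓ uplus uminus : ℝ}
    (hℓ : ℓ ≤ Real.log (Matrix.partitionFn β ((FermionInteraction.linearFamily Ψ₀ Ψv θ).localHamiltonian (halfOpenBox d n))).re)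
    (hup : Real.log (Matrix.partitionFn β
      ((FermionInteraction.linearFamily Ψ₀ Ψv (θ + Pi.single a δ)).localHamiltonian (halfOpenBox d n))).re ≤ uplus)
    (hum : Real.log (Matrix.partitionFn β
      ((FermionInteraction.linearFamily Ψ₀ Ψv (θ + Pi.single a (-δ))).localHamiltonian (halfOpenBox d n))).re ≤ uminus) :
    ν.meanEnergy (Ψv a) R ∈ Set.Icc
      ((((ℓ + β * (((FermionInteraction.linearFamily Ψ₀ Ψv θ).Φ ∅) ∅ ∅).re) / (n : ℝ) ^ d -
          |β| * ((((thicken (halfOpenBox d n) R \ halfOpenBox d n).card : ℝ) *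
            ∑ X ∈ (thicken ({0} : Finset (Site d)) R).powerset with (0 : Site d) ∈ X,
              ‖(FermionInteraction.linearFamily Ψ₀ Ψv θ).Φ X‖) / (n : ℝ) ^ d)) -
        ((uplus + β * (((FermionInteraction.linearFamily Ψ₀ Ψv (θ + Pi.single a δ)).Φ ∅) ∅ ∅).re) / (n : ℝ) ^ d +
          |β| * ((((thicken (halfOpenBox d n) R \ halfOpenBox d n).card : ℝ) *
            ∑ X ∈ (thicken ({0} : Finset (Site d)) R).powerset with (0 : Site d) ∈ X,
              ‖(FermionInteraction.linearFamily Ψ₀ Ψv (θ + Pi.single a δ)).Φ X‖) / (n : ℝ) ^ d)) - ε) / (β * δ))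
      ((((uminus + β * (((FermionInteraction.linearFamily Ψ₀ Ψv (θ + Pi.single a (-δ))).Φ ∅) ∅ ∅).re) / (n : ℝ) ^ d +
          |β| * ((((thicken (halfOpenBox d n) R \ halfOpenBox d n).card : ℝ) *
            ∑ X ∈ (thicken ({0} : Finset (Site d)) R).powerset with (0 : Site d) ∈ X,
              ‖(FermionInteraction.linearFamily Ψ₀ Ψv (θ + Pi.single a (-δ))).Φ X‖) / (n : ℝ) ^ d)) -
        ((ℓ + β * (((FermionInteraction.linearFamily Ψ₀ Ψv θ).Φ ∅) ∅ ∅).re) / (n : ℝ) ^ d -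
          |β| * ((((thicken (halfOpenBox d n) R \ halfOpenBox d n).card : ℝ) *
            ∑ X ∈ (thicken ({0} : Finset (Site d)) R).powerset with (0 : Site d) ∈ X,
              ‖(FermionInteraction.linearFamily Ψ₀ Ψv θ).Φ X‖) / (n : ℝ) ^ d)) + ε) / (β * δ)) :=
  meanEnergy_mem_Icc_of_approx_of_bounds hν hβ h a hδ
    (FermionInteraction.le_varPressure_of_le_log_partitionFn hd (FermionInteraction.isHermitian_linearFamily h₀H hvH _)
      (FermionInteraction.isEven_linearFamily h₀E hvE _) (FermionInteraction.isTranslationInvariant_linearFamily h₀T hvT _)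
      (FermionInteraction.hasFiniteRange_linearFamily h₀R hvR _) β hn hℓ)
    (FermionInteraction.varPressure_le_of_log_partitionFn_le hd (FermionInteraction.isHermitian_linearFamily h₀H hvH _)
      (FermionInteraction.isTranslationInvariant_linearFamily h₀T hvT _) (FermionInteraction.hasFiniteRange_linearFamily h₀R hvR _) β hn hup)
    (FermionInteraction.varPressure_le_of_log_partitionFn_le hd (FermionInteraction.isHermitian_linearFamily h₀H hvH _)
      (FermionInteraction.isTranslationInvariant_linearFamily h₀T hvT _) (FermionInteraction.hasFiniteRange_linearFamily h₀R hvR _) β hn hum)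

end CouplingsBox

end InfVolFermionState

end Literature.MathematicalPhysics.QuantumLattice

end
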